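import Summits.AtomisticToContinuum.HydrodynamicLimit.Theorems.CollisionIsometryCLTCollisionalTransferLocalityDefs
import Summits.AtomisticToContinuum.HydrodynamicLimit.Theses.StiffCollisionalRelaxation
import HarnessLib

/-!
# Bounded compressibility on the density window from Ruelle convexity

Helper file (`--supports stmt-AtomisticToContinuum-9518`, line `hemisphere-affine-slaving`) for the
registered stub `stub_weightedKineticRelaxation` ([C]) of the crux `CollisionalTransferLocality`:
sublemma (Z) of its proof. From the route item `HsFreeEnergyConvex` (convexity of minus the
hard-sphere entropy density on the chamber `{0 < ρ, ρσ³ < 11/10, |m|² < 2ρE}`), restricted to the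
segment `m = 0`, `E = 3/2`, where it is `g(ρ) = (5/2) ρ log ρ + ρ f_ex(ρσ³)`, we get
`|Z(ρσ³) − 1| ≤ C_Z` for `c₁ ≤ ρ ≤ σ⁻³` (`Z = hsCompressibility = 1 + η f_ex'(η)`): a convex function
on an open interval is continuous, hence bounded on the compact `[c₁/2, (21/20)σ⁻³]`, so its secant
slopes — and its derivative wherever it exists — are bounded on `[c₁, σ⁻³]`; where `f_ex` is not
differentiable the `deriv`-junk `0` gives `Z − 1 = 0`. Sources: Ruelle 1969 §3.4 (convexity of the
free energy); Mathlib `ConvexOn.continuousOn`, `ConvexOn.le_slope_of_hasDerivAt`,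
`ConvexOn.slope_le_of_hasDerivAt`. No dynamics, no probability here.
-/

namespace Summit.AtomisticToContinuum.HydrodynamicLimit.Theorems.HemisphereAffineSlaving

open scoped BigOperators Topology Classical
open Filter Set Function

noncomputable section

open Literature.MathematicalPhysics.KineticTheory (T3 V3 hsExcessFreeEnergy hsCompressibility)

/-- On the segment `U = (r, 0, 3/2)`, `r > 0`, minus the entropy density is
`(5/2) r log r + r f_ex(r σ³)`. [folklore] -/
theorem negEntropy_segment {σ r : ℝ} (hr : 0 < r) :
    -(r * (3 / 2 * Real.log (2 / 3 * ((3 / 2 : ℝ) / r - ‖(0 : V3)‖ ^ 2 / (2 * r ^ 2))) -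
      Real.log r - hsExcessFreeEnergy (r * σ ^ 3))) =
      5 / 2 * (r * Real.log r) + r * hsExcessFreeEnergy (r * σ ^ 3) := by
  have h1 : 2 / 3 * ((3 / 2 : ℝ) / r - ‖(0 : V3)‖ ^ 2 / (2 * r ^ 2)) = r⁻¹ := by
    rw [norm_zero]; field_simp; ring
  rw [h1, Real.log_inv]
  ring

/-- Ruelle convexity restricted to the segment `m = 0`, `E = 3/2`: `r ↦ (5/2) r log r + r f_ex(rσ³)`
is convex on `(0, (11/10) σ⁻³)`. [folklore] -/
theorem convexOn_segment
    (hH : Summit.AtomisticToContinuum.HydrodynamicLimit.Theses.StiffCollisionalRelaxation.HsFreeEnergyConvex)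
    {σ : ℝ} (hσ : 0 < σ) : ConvexOn ℝ (Ioo 0 (11 / 10 * (1 / σ ^ 3)))
      (fun r : ℝ => 5 / 2 * (r * Real.log r) + r * hsExcessFreeEnergy (r * σ ^ 3)) := by
  have hσ3 : 0 < σ ^ 3 := pow_pos hσ 3
  set e : ℝ → ℝ × V3 × ℝ := fun r => (r, 0, 3 / 2) with he
  have hmem : ∀ r ∈ Ioo (0 : ℝ) (11 / 10 * (1 / σ ^ 3)),
      e r ∈ {U : ℝ × (EuclideanSpace ℝ (Fin 3)) × ℝ |
        0 < U.1 ∧ U.1 * σ ^ 3 < 11 / 10 ∧ ‖U.2.1‖ ^ 2 < 2 * U.1 * U.2.2} := by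
    intro r hr
    refine ⟨hr.1, ?_, ?_⟩
    · have h := mul_lt_mul_of_pos_right hr.2 hσ3
      have h2 : 11 / 10 * (1 / σ ^ 3) * σ ^ 3 = 11 / 10 := by field_simp
      rwa [h2] at h
    · simp only [he, norm_zero]; nlinarith [hr.1]
  refine ⟨convex_Ioo _ _, fun x hx y hy a b ha hb hab => ?_⟩
  have key := (hH σ hσ).2 (hmem x hx) (hmem y hy) ha hb hab
  have hcombo : a • e x + b • e y = e (a • x + b • y) := by
    simp only [he, Prod.smul_mk, Prod.mk_add_mk, smul_zero, add_zero, smul_eq_mul]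
    refine Prod.ext rfl (Prod.ext rfl ?_)
    simp only
    rw [← add_mul, hab, one_mul]
  rw [hcombo] at key
  have hcpos : 0 < a • x + b • y := by
    rcases ha.lt_or_eq with ha' | ha'
    · simp only [smul_eq_mul]; nlinarith [hx.1, hy.1]
    · subst ha'; simp only [zero_add] at hab; subst hab; simp [hy.1]
  simpa only [he, negEntropy_segment hx.1, negEntropy_segment hy.1, negEntropy_segment hcpos]
    using key

/-- **(Z) Bounded compressibility on the density window** (helper stub of
`stub_weightedKineticRelaxation`, crux stmt-AtomisticToContinuum-9518, line hemisphere-affine-slaving).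
Ruelle convexity of the free energy implies `|Z(r σ³) − 1| ≤ C_Z` for `c₁ ≤ r`, `r σ³ ≤ 1`: secant
slopes of the convex segment function are bounded on `[c₁, σ⁻³]` by its sup on the compact
`[c₁/2, (21/20)σ⁻³]` inside the open interval of convexity (where it is continuous), hence so is its
derivative where it exists, and `r σ³ f_ex' = g' − (5/2)(log r + 1) − f_ex`; where `f_ex` is not
differentiable the `deriv`-junk `0` gives `Z − 1 = 0`. [folklore] -/
theorem abs_hsCompressibility_sub_one_le :
    Summit.AtomisticToContinuum.HydrodynamicLimit.Theses.StiffCollisionalRelaxation.HsFreeEnergyConvex →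
    ∀ σ : ℝ, 0 < σ → ∀ c₁ : ℝ, 0 < c₁ → ∃ C : ℝ, 0 ≤ C ∧ ∀ r : ℝ, c₁ ≤ r → r * σ ^ 3 ≤ 1 →
      |Literature.MathematicalPhysics.KineticTheory.hsCompressibility (r * σ ^ 3) - 1| ≤ C := by
  intro hH σ hσ c₁ hc₁
  have hσ3 : 0 < σ ^ 3 := pow_pos hσ 3
  set R : ℝ := 1 / σ ^ 3 with hR
  have hRpos : 0 < R := by positivity
  have hrR_of : ∀ r : ℝ, r * σ ^ 3 ≤ 1 → r ≤ R := fun r h => by rwa [hR, le_div_iff₀ hσ3]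
  by_cases hcR : c₁ ≤ R
  swap
  · exact ⟨0, le_rfl, fun r hr hr1 => (hcR (hr.trans (hrR_of r hr1))).elim⟩
  set g : ℝ → ℝ := fun r => 5 / 2 * (r * Real.log r) + r * hsExcessFreeEnergy (r * σ ^ 3) with hg
  have hconv : ConvexOn ℝ (Ioo 0 (11 / 10 * R)) g := convexOn_segment hH hσ
  set p : ℝ := c₁ / 2 with hp_def
  set q : ℝ := 21 / 20 * R with hq_def
  have hp : 0 < p := by positivity
  have hpq : p ≤ q := by rw [hp_def, hq_def]; linarith
  have hsub : Icc p q ⊆ Ioo 0 (11 / 10 * R) := fun x hx =>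
    ⟨lt_of_lt_of_le hp hx.1, lt_of_le_of_lt hx.2 (by rw [hq_def]; nlinarith)⟩
  obtain ⟨M, hM⟩ := isCompact_Icc.exists_bound_of_continuousOn
    ((hconv.continuousOn isOpen_Ioo).mono hsub)
  have hMabs : ∀ x, p ≤ x → x ≤ q → |g x| ≤ M := fun x h1 h2 => by
    simpa [Real.norm_eq_abs] using hM x ⟨h1, h2⟩
  have hM0 : 0 ≤ M := le_trans (abs_nonneg _) (hMabs p le_rfl hpq)
  have hqR : 0 < q - R := by rw [hq_def]; linarith
  have hcp : 0 < c₁ - p := by rw [hp_def]; linarith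
  set K₁ : ℝ := 2 * M / (q - R) + 2 * M / (c₁ - p) with hK₁
  set L : ℝ := max |Real.log c₁| |Real.log R| with hL
  have hL0 : 0 ≤ L := le_trans (abs_nonneg _) (le_max_left _ _)
  refine ⟨K₁ + 5 / 2 * (L + 1) + (M / c₁ + 5 / 2 * L), by positivity, fun r hr hr1 => ?_⟩
  have hrR : r ≤ R := hrR_of r hr1
  have hr0 : 0 < r := lt_of_lt_of_le hc₁ hr
  have hpr : p < r := by rw [hp_def]; linarith
  have hrq : r < q := by rw [hq_def]; linarith
  have hlog : |Real.log r| ≤ L := by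
    rcases le_or_gt 0 (Real.log r) with h | h
    · rw [abs_of_nonneg h]
      exact le_trans ((Real.log_le_log hr0 hrR).trans (le_abs_self _)) (le_max_right _ _)
    · rw [abs_of_neg h]
      exact le_trans ((neg_le_neg (Real.log_le_log hc₁ hr)).trans (neg_le_abs _)) (le_max_left _ _)
  have hgr : |g r| ≤ M := hMabs r hpr.le hrq.le
  have hgp : |g p| ≤ M := hMabs p le_rfl hpq
  have hgq : |g q| ≤ M := hMabs q hpq le_rfl
  show |1 + r * σ ^ 3 * deriv hsExcessFreeEnergy (r * σ ^ 3) - 1| ≤ _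
  rw [add_sub_cancel_left]
  by_cases hd : DifferentiableAt ℝ hsExcessFreeEnergy (r * σ ^ 3)
  swap
  · rw [deriv_zero_of_not_differentiableAt hd, mul_zero, abs_zero]
    positivity
  set f' := deriv hsExcessFreeEnergy (r * σ ^ 3) with hf'
  have h_fe : HasDerivAt (fun x => hsExcessFreeEnergy (x * σ ^ 3)) (f' * σ ^ 3) r := by
    have := hd.hasDerivAt.comp r (hasDerivAt_mul_const (σ ^ 3))
    simpa [Function.comp_def] using this
  have h_h : HasDerivAt (fun x => x * hsExcessFreeEnergy (x * σ ^ 3))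
      (1 * hsExcessFreeEnergy (r * σ ^ 3) + r * (f' * σ ^ 3)) r := (hasDerivAt_id r).mul h_fe
  set g' : ℝ := 5 / 2 * (Real.log r + 1) + (1 * hsExcessFreeEnergy (r * σ ^ 3) + r * (f' * σ ^ 3))
    with hg'
  have h_g : HasDerivAt g g' r := by
    refine (((Real.hasDerivAt_mul_log hr0.ne').const_mul (5 / 2 : ℝ)).add h_h).congr_of_eventuallyEq
      (Eventually.of_forall fun x => ?_)
    simp [hg]
  have hrS : r ∈ Ioo 0 (11 / 10 * R) := ⟨hr0, by linarith⟩
  have hup : g' ≤ slope g r q := hconv.le_slope_of_hasDerivAt hrS (hsub ⟨hpq, le_rfl⟩) hrq h_g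
  have hlo : slope g p r ≤ g' := hconv.slope_le_of_hasDerivAt (hsub ⟨le_rfl, hpq⟩) hrS hpr h_g
  rw [slope_def_field] at hup hlo
  have hup' : g' ≤ 2 * M / (q - R) := by
    calc g' ≤ (g q - g r) / (q - r) := hup
      _ ≤ 2 * M / (q - r) := by
          apply div_le_div_of_nonneg_right _ (by linarith)
          linarith [neg_abs_le (g r), le_abs_self (g q)]
      _ ≤ 2 * M / (q - R) := div_le_div_of_nonneg_left (by positivity) hqR (by linarith)
  have hlo' : -(2 * M / (c₁ - p)) ≤ g' := by
    rw [neg_le]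
    calc -g' ≤ -((g r - g p) / (r - p)) := neg_le_neg hlo
      _ = (g p - g r) / (r - p) := by rw [← neg_div, neg_sub]
      _ ≤ 2 * M / (r - p) := by
          apply div_le_div_of_nonneg_right _ (by linarith)
          linarith [neg_abs_le (g r), le_abs_self (g p)]
      _ ≤ 2 * M / (c₁ - p) := div_le_div_of_nonneg_left (by positivity) hcp (by linarith)
  have hg'abs : |g'| ≤ K₁ := by
    have h1 : (0 : ℝ) ≤ 2 * M / (q - R) := by positivity
    have h2 : (0 : ℝ) ≤ 2 * M / (c₁ - p) := by positivity
    rw [abs_le]; constructor <;> linarith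
  have hfe_abs : |hsExcessFreeEnergy (r * σ ^ 3)| ≤ M / c₁ + 5 / 2 * L := by
    have hfe_eq : hsExcessFreeEnergy (r * σ ^ 3) = (g r - 5 / 2 * (r * Real.log r)) / r := by
      rw [eq_div_iff hr0.ne']; simp only [hg]; ring
    rw [hfe_eq, abs_div, abs_of_pos hr0, div_le_iff₀ hr0]
    calc |g r - 5 / 2 * (r * Real.log r)| ≤ |g r| + |5 / 2 * (r * Real.log r)| := abs_sub _ _
      _ = |g r| + 5 / 2 * (r * |Real.log r|) := by
          rw [abs_mul, abs_mul, abs_of_pos hr0, abs_of_pos (by norm_num : (0 : ℝ) < 5 / 2)]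
      _ ≤ M + 5 / 2 * (r * L) := by gcongr
      _ ≤ (M / c₁ + 5 / 2 * L) * r := by
          rw [add_mul]
          have : M ≤ M / c₁ * r := by
            rw [div_mul_eq_mul_div, le_div_iff₀ hc₁]
            exact mul_le_mul_of_nonneg_left hr hM0
          nlinarith
  have hkey : r * σ ^ 3 * f' = g' - 5 / 2 * (Real.log r + 1) - hsExcessFreeEnergy (r * σ ^ 3) := by
    rw [hg']; ring
  rw [hkey]
  calc |g' - 5 / 2 * (Real.log r + 1) - hsExcessFreeEnergy (r * σ ^ 3)|
      ≤ |g' - 5 / 2 * (Real.log r + 1)| + |hsExcessFreeEnergy (r * σ ^ 3)| := abs_sub _ _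
    _ ≤ (|g'| + |5 / 2 * (Real.log r + 1)|) + |hsExcessFreeEnergy (r * σ ^ 3)| := by
        gcongr; exact abs_sub _ _
    _ ≤ (K₁ + 5 / 2 * (L + 1)) + (M / c₁ + 5 / 2 * L) := by
        gcongr
        rw [abs_mul, abs_of_pos (by norm_num : (0 : ℝ) < 5 / 2)]
        gcongr
        calc |Real.log r + 1| ≤ |Real.log r| + |1| := abs_add_le _ _
          _ ≤ L + 1 := by rw [abs_one]; gcongr

end

end Summit.AtomisticToContinuum.HydrodynamicLimit.Theorems.HemisphereAffineSlaving
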